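import Literature.NumberTheory.GaloisRepresentations.AdZeroBlochKatoDatum
import Literature.NumberTheory.GaloisRepresentations.ResidualGaloisRep
import HarnessLib

/-!
# Helpers for stub S1 (`stub_residualAdjointForm`) of crux `AdjointLiftingGL3`, line `birth`, II:
# conjugacy from equivalence, irreducibility under conjugation and scalar twists,
# `Ad⁰ τ₀` irreducible ⇒ `τ₀` irreducible

Crux `stmt-Langlands-16779` = `Summit.Langlands.Langlands.Theses.RamifiedCoefficientSeed.AdjointLiftingGL3`
(line `birth`, skeleton v4).  Pure representation theory over a field (the tree's `glRepresentation`,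
`IsAbsIrreducible` of `ResidualGaloisRep`; the fixed frame `glAdZeroTwoFrame` of `Ad⁰` on `sl₂`,
file `AdZeroBlochKatoDatum`), all PROVED, used by the sibling file
`RamifiedCoefficientSeedAdjointLiftingGL3StubResidualAdjointForm.lean`:

* `exists_conj_of_equiv` — an equivalence of the representations on `kⁿ` through
  `σ, τ : G → GL_n(k)` is given by a matrix: `τ = P σ P⁻¹` (adapted from
  `exists_conj_of_equiv_map` of `PhantomRMYoshidaResiduallyYoshidaLiftingTraceLimitResidual`).
* `isIrreducible_of_conj`, `isIrreducible_of_smul`, `isIrreducible_of_conj_smul`,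
  `IsAbsIrreducible.of_conj_smul` — if `τ(g) = P (c(g) · μ(g)) P⁻¹` for all `g` and `τ` is
  (absolutely) irreducible then so is `μ` (conjugation is an equivalence of representations,
  `nonempty_equiv_of_conj`; a `μ`-stable subspace is stable under scalar multiples of `μ`).
* `coe_adZeroTwoEquiv_symm_glAdZeroTwoFrame_mulVec` — in the coordinates
  `x ↦ (x₀ x₁; x₂ −x₀)` of `sl₂` the frame acts by conjugation, `Ad⁰(P) x ↦ P (…) P⁻¹`;
  **`isIrreducible_of_isIrreducible_adZero`** (the registered sub-goal of this file) — for
  `τ₀ : G → GL₂(k)`: if `Ad⁰ τ₀` (in the fixed frame) is irreducible on `k³` then `τ₀` is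
  irreducible on `k²` (a `τ₀`-stable line `L` gives the `Ad`-stable line `Hom(k²/L, L) ⊂ sl₂`).

## References

* [BourbakiAlgebreVIII2012] N. Bourbaki, *Algèbre* VIII (2012), § 20 n° 6 (equivalent
  representations; Brauer–Nesbitt).
* [DarmonDiamondTaylor1995] H. Darmon, F. Diamond, R. Taylor, *Fermat's Last Theorem* (1995), §2.1.
* [ACCGHLNSTT2023] P. B. Allen et al., *Potential automorphy over CM fields*, Def. 6.2.28 (`ad⁰`).
-/

set_option linter.dupNamespace false

noncomputable section

namespace Summit.Langlands.Langlands.Cruxes.AdjointLiftingGL3.Birth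

open scoped MatrixGroups Matrix
open Literature.NumberTheory.GaloisRepresentations

universe u v w

/-! ## §1. Conjugacy from an equivalence of `glRepresentation`s -/

section Conj

variable {G : Type u} [Group G] {k : Type w} [Field k] {n : ℕ}

/-- The matrix of `glRepresentation σ g` in the standard basis is `σ g`. [folklore] -/
theorem toMatrix'_glRepresentation (σ : G →* GL (Fin n) k) (g : G) :
    LinearMap.toMatrix' (glRepresentation σ g : (Fin n → k) →ₗ[k] (Fin n → k)) =
      ((σ g : GL (Fin n) k) : Matrix (Fin n) (Fin n) k) := by
  have : (glRepresentation σ g : (Fin n → k) →ₗ[k] (Fin n → k)) =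
      Matrix.toLin' ((σ g : GL (Fin n) k) : Matrix (Fin n) (Fin n) k) :=
    LinearMap.ext fun v => by rw [Matrix.toLin'_apply]; rfl
  rw [this, LinearMap.toMatrix'_toLin']

/-- **Equivalent matrix representations are conjugate**: an equivalence
`e : kⁿ_σ ≃ kⁿ_τ` of the representations through `σ, τ : G → GL_n(k)` has an invertible matrix
`P` (that of `e`) with `τ(g) = P σ(g) P⁻¹` for all `g`. [folklore] -/
theorem exists_conj_of_equiv {σ τ : G →* GL (Fin n) k}
    (e : (glRepresentation σ).Equiv (glRepresentation τ)) :
    ∃ P : GL (Fin n) k, ∀ g, ((τ g : GL (Fin n) k) : Matrix (Fin n) (Fin n) k) =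
      (P : Matrix (Fin n) (Fin n) k) * ((σ g : GL (Fin n) k) : Matrix (Fin n) (Fin n) k) *
        ((P⁻¹ : GL (Fin n) k) : Matrix (Fin n) (Fin n) k) := by
  -- adapted from `exists_conj_of_equiv_map` (PhantomRMYoshida…TraceLimitResidual)
  classical
  set L : (Fin n → k) ≃ₗ[k] (Fin n → k) := e.toLinearEquiv with hL
  set H : Matrix (Fin n) (Fin n) k := LinearMap.toMatrix' (L : (Fin n → k) →ₗ[k] (Fin n → k))
    with hH
  set H' : Matrix (Fin n) (Fin n) k :=
    LinearMap.toMatrix' (L.symm : (Fin n → k) →ₗ[k] (Fin n → k)) with hH'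
  have hHH' : H * H' = 1 := by
    rw [hH, hH', ← LinearMap.toMatrix'_comp, LinearEquiv.comp_symm, LinearMap.toMatrix'_id]
  have hH'H : H' * H = 1 := by
    rw [hH, hH', ← LinearMap.toMatrix'_comp, LinearEquiv.symm_comp, LinearMap.toMatrix'_id]
  have hint : ∀ g, H * ((σ g : GL (Fin n) k) : Matrix (Fin n) (Fin n) k) =
      ((τ g : GL (Fin n) k) : Matrix (Fin n) (Fin n) k) * H := fun g => by
    have h1 : (L : (Fin n → k) →ₗ[k] (Fin n → k)) ∘ₗ (glRepresentation σ g) =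
        (glRepresentation τ g) ∘ₗ (L : (Fin n → k) →ₗ[k] (Fin n → k)) :=
      e.toIntertwiningMap.isIntertwining' g
    have h2 := congrArg LinearMap.toMatrix' h1
    rw [LinearMap.toMatrix'_comp, LinearMap.toMatrix'_comp, toMatrix'_glRepresentation,
      toMatrix'_glRepresentation] at h2
    exact h2
  refine ⟨⟨H, H', hHH', hH'H⟩, fun g => ?_⟩
  change _ = H * _ * H'
  calc ((τ g : GL (Fin n) k) : Matrix (Fin n) (Fin n) k)
      = ((τ g : GL (Fin n) k) : Matrix (Fin n) (Fin n) k) * (H * H') := by rw [hHH', Matrix.mul_one]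
    _ = ((τ g : GL (Fin n) k) : Matrix (Fin n) (Fin n) k) * H * H' := by rw [Matrix.mul_assoc]
    _ = H * ((σ g : GL (Fin n) k) : Matrix (Fin n) (Fin n) k) * H' := by rw [hint g]

/-! ## §2. Irreducibility is invariant under conjugation and scalar twists -/

/-- The representation on `kⁿ` through `τ = P σ P⁻¹` is equivalent to the one through `σ`
(the equivalence is `v ↦ P v`). [folklore] -/
theorem nonempty_equiv_of_conj {σ τ : G →* GL (Fin n) k} (P : GL (Fin n) k)
    (h : ∀ g, ((τ g : GL (Fin n) k) : Matrix (Fin n) (Fin n) k) =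
      (P : Matrix (Fin n) (Fin n) k) * ((σ g : GL (Fin n) k) : Matrix (Fin n) (Fin n) k) *
        ((P⁻¹ : GL (Fin n) k) : Matrix (Fin n) (Fin n) k)) :
    Nonempty ((glRepresentation σ).Equiv (glRepresentation τ)) := by
  refine ⟨Representation.Equiv.mk (Matrix.GeneralLinearGroup.toLin P).toLinearEquiv fun g => ?_⟩
  refine LinearMap.ext fun v => ?_
  change (P : Matrix (Fin n) (Fin n) k) *ᵥ (((σ g : GL (Fin n) k) : Matrix (Fin n) (Fin n) k) *ᵥ v) =
    ((τ g : GL (Fin n) k) : Matrix (Fin n) (Fin n) k) *ᵥ ((P : Matrix (Fin n) (Fin n) k) *ᵥ v)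
  rw [h g, Matrix.mulVec_mulVec, Matrix.mulVec_mulVec, Matrix.mul_assoc, Matrix.mul_assoc,
    Units.inv_mul, Matrix.mul_one]

/-- Irreducibility is invariant under conjugation: `τ = P σ P⁻¹` irreducible iff `σ` is; here
the direction `σ ⇒ τ`. [folklore] -/
theorem isIrreducible_of_conj {σ τ : G →* GL (Fin n) k} (P : GL (Fin n) k)
    (h : ∀ g, ((τ g : GL (Fin n) k) : Matrix (Fin n) (Fin n) k) =
      (P : Matrix (Fin n) (Fin n) k) * ((σ g : GL (Fin n) k) : Matrix (Fin n) (Fin n) k) *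
        ((P⁻¹ : GL (Fin n) k) : Matrix (Fin n) (Fin n) k))
    (hσ : (glRepresentation σ).IsIrreducible) : (glRepresentation τ).IsIrreducible := by
  haveI := hσ
  obtain ⟨e⟩ := nonempty_equiv_of_conj P h
  exact Literature.RepresentationTheory.Semisimple.Representation.isIrreducible_of_equiv e

/-- **A scalar twist does not change the stable subspaces**: if `τ(g) = c(g) · σ(g)` for all `g`
and `τ` is irreducible on `kⁿ`, so is `σ` (every `σ`-stable subspace is `τ`-stable). [folklore] -/
theorem isIrreducible_of_smul {σ τ : G →* GL (Fin n) k} (c : G → k)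
    (h : ∀ g, ((τ g : GL (Fin n) k) : Matrix (Fin n) (Fin n) k) =
      c g • ((σ g : GL (Fin n) k) : Matrix (Fin n) (Fin n) k))
    (hτ : (glRepresentation τ).IsIrreducible) : (glRepresentation σ).IsIrreducible := by
  set T := glRepresentation τ with hTdef
  set R := glRepresentation σ with hRdef
  have stable : ∀ (W : Subrepresentation R) (g : G) ⦃v : Fin n → k⦄,
      v ∈ W.toSubmodule → T g v ∈ W.toSubmodule := by
    intro W g v hv
    have e : T g v = c g • R g v := by
      simp only [hTdef, hRdef, glRepresentation_apply_apply, h g, Matrix.smul_mulVec]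
    rw [e]
    exact W.toSubmodule.smul_mem _ (W.apply_mem_toSubmodule g hv)
  haveI := hτ
  have hbotT : (⊥ : Subrepresentation T).toSubmodule = ⊥ := rfl
  have htopT : (⊤ : Subrepresentation T).toSubmodule = ⊤ := rfl
  have hbotR : (⊥ : Subrepresentation R).toSubmodule = ⊥ := rfl
  have htopR : (⊤ : Subrepresentation R).toSubmodule = ⊤ := rfl
  refine { toNontrivial := ⟨⟨⊥, ⊤, fun hbt ↦ ?_⟩⟩, eq_bot_or_eq_top := fun W ↦ ?_ }
  · apply (bot_ne_top : (⊥ : Subrepresentation T) ≠ ⊤)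
    apply Subrepresentation.toSubmodule_injective
    rw [hbotT, htopT, ← hbotR, ← htopR, hbt]
  · let W' : Subrepresentation T := ⟨W.toSubmodule, stable W⟩
    have hW' : W'.toSubmodule = W.toSubmodule := rfl
    rcases eq_bot_or_eq_top W' with h0 | h1
    · refine Or.inl (Subrepresentation.toSubmodule_injective ?_)
      rw [hbotR, ← hbotT, ← h0, hW']
    · refine Or.inr (Subrepresentation.toSubmodule_injective ?_)
      rw [htopR, ← htopT, ← h1, hW']

/-- **Irreducibility passes from `τ = P (c · μ) P⁻¹` to `μ`** (conjugation, then the scalar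
twist). [folklore] -/
theorem isIrreducible_of_conj_smul {τ μ : G →* GL (Fin n) k} (P : GL (Fin n) k) (c : G → k)
    (h : ∀ g, ((τ g : GL (Fin n) k) : Matrix (Fin n) (Fin n) k) =
      (P : Matrix (Fin n) (Fin n) k) * (c g • ((μ g : GL (Fin n) k) : Matrix (Fin n) (Fin n) k)) *
        ((P⁻¹ : GL (Fin n) k) : Matrix (Fin n) (Fin n) k))
    (hτ : (glRepresentation τ).IsIrreducible) : (glRepresentation μ).IsIrreducible := by
  -- `τ' := P⁻¹ τ P = c · μ`
  set τ' : G →* GL (Fin n) k := (MulAut.conj P⁻¹).toMonoidHom.comp τ with hτ'def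
  have hτ' : ∀ g, ((τ' g : GL (Fin n) k) : Matrix (Fin n) (Fin n) k) =
      c g • ((μ g : GL (Fin n) k) : Matrix (Fin n) (Fin n) k) := fun g => by
    rw [hτ'def, MonoidHom.comp_apply, MulEquiv.coe_toMonoidHom, MulAut.conj_apply, inv_inv,
      Units.val_mul, Units.val_mul, h g]
    rw [← Matrix.mul_assoc, ← Matrix.mul_assoc, Units.inv_mul, Matrix.one_mul, Matrix.mul_assoc,
      Units.inv_mul, Matrix.mul_one]
  have hconj : ∀ g, ((τ' g : GL (Fin n) k) : Matrix (Fin n) (Fin n) k) =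
      ((P⁻¹ : GL (Fin n) k) : Matrix (Fin n) (Fin n) k) * ((τ g : GL (Fin n) k) : Matrix (Fin n) (Fin n) k) *
        (((P⁻¹)⁻¹ : GL (Fin n) k) : Matrix (Fin n) (Fin n) k) := fun g => by
    rw [hτ'def, MonoidHom.comp_apply, MulEquiv.coe_toMonoidHom, MulAut.conj_apply, Units.val_mul,
      Units.val_mul]
  exact isIrreducible_of_smul c hτ' (isIrreducible_of_conj P⁻¹ hconj hτ)

/-- **Absolute irreducibility passes from `τ = P (c · μ) P⁻¹` to `μ`**: after every extension of
scalars `f : k → k'` the same identity holds with `GL_n(f) P` and `f ∘ c`. [folklore] -/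
theorem IsAbsIrreducible.of_conj_smul {τ μ : G →* GL (Fin n) k} (P : GL (Fin n) k) (c : G → k)
    (h : ∀ g, ((τ g : GL (Fin n) k) : Matrix (Fin n) (Fin n) k) =
      (P : Matrix (Fin n) (Fin n) k) * (c g • ((μ g : GL (Fin n) k) : Matrix (Fin n) (Fin n) k)) *
        ((P⁻¹ : GL (Fin n) k) : Matrix (Fin n) (Fin n) k))
    (hτ : IsAbsIrreducible τ) : IsAbsIrreducible μ := by
  intro k' _ f
  refine isIrreducible_of_conj_smul (Matrix.GeneralLinearGroup.map f P) (fun g => f (c g))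
    (fun g => ?_) (hτ k' f)
  rw [← map_inv]
  change ((τ g : GL (Fin n) k) : Matrix (Fin n) (Fin n) k).map f =
    (P : Matrix (Fin n) (Fin n) k).map f * (f (c g) • ((μ g : GL (Fin n) k) : Matrix (Fin n) (Fin n) k).map f) *
      ((P⁻¹ : GL (Fin n) k) : Matrix (Fin n) (Fin n) k).map f
  rw [h g, Matrix.map_mul, Matrix.map_mul, Matrix.map_smul' f _ _ (map_mul f)]

end Conj

/-! ## §3. `Ad⁰ τ₀` irreducible ⇒ `τ₀` irreducible (rank two, fixed frame) -/

section AdZeroIrred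

variable {G : Type u} [Group G] {k : Type w} [Field k]

/-- **The frame acts by conjugation**: in the coordinates `x ↦ (x₀ x₁; x₂ −x₀)` of `sl₂`
(`adZeroTwoEquiv`), `Ad⁰(P) x` is `P (x₀ x₁; x₂ −x₀) P⁻¹` (the frame is the matrix of
`M ↦ P M P⁻¹` in the basis `adZeroTwoBasis`, Mathlib `LinearMap.toMatrix_mulVec_repr`). [folklore] -/
theorem coe_adZeroTwoEquiv_symm_glAdZeroTwoFrame_mulVec (P : GL (Fin 2) k) (x : Fin 3 → k) :
    (((adZeroTwoEquiv k).symm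
        ((((glAdZeroTwoFrame k P : GL (Fin 3) k) : Matrix (Fin 3) (Fin 3) k)) *ᵥ x) :
        ↥(adZeroSubmodule (Fin 2) k)) : Matrix (Fin 2) (Fin 2) k) =
      (P : Matrix (Fin 2) (Fin 2) k) *
        (((adZeroTwoEquiv k).symm x : ↥(adZeroSubmodule (Fin 2) k)) : Matrix (Fin 2) (Fin 2) k) *
        ((P⁻¹ : GL (Fin 2) k) : Matrix (Fin 2) (Fin 2) k) := by
  have hrepr : ∀ y : ↥(adZeroSubmodule (Fin 2) k),
      ⇑((adZeroTwoBasis k).repr y) = adZeroTwoEquiv k y := fun y =>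
    funext fun i => Module.Basis.ofEquivFun_repr_apply _ _ _
  have hval : ((glAdZeroTwoFrame k P : GL (Fin 3) k) : Matrix (Fin 3) (Fin 3) k) =
      LinearMap.toMatrix (adZeroTwoBasis k) (adZeroTwoBasis k)
        (glAdZeroRepresentation (Fin 2) k P) := rfl
  have hx : x = ⇑((adZeroTwoBasis k).repr ((adZeroTwoEquiv k).symm x)) := by
    rw [hrepr, LinearEquiv.apply_symm_apply]
  conv_lhs => rw [hx, hval, LinearMap.toMatrix_mulVec_repr, hrepr, LinearEquiv.symm_apply_apply]
  rw [coe_glAdZeroRepresentation_apply]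

/-- **`Ad⁰ τ₀` irreducible ⇒ `τ₀` irreducible** (`τ₀ : G → GL₂(k)`, `Ad⁰` in the fixed frame
`glAdZeroTwoFrame`): a `τ₀`-stable line `L = k v ⊂ k²` gives the non-zero proper `Ad`-stable
subspace `{M ∈ sl₂ : M v = 0, M(k²) ⊆ L} = Hom(k²/L, L)` (it contains `v ⊗ det(v, ·)` and
misses `diag(1, −1)`). [folklore] -/
theorem isIrreducible_of_isIrreducible_adZero :
    ∀ {G : Type*} [Group G] {k : Type*} [Field k] (τ₀ : G →* GL (Fin 2) k),
      (glRepresentation ((glAdZeroTwoFrame k).comp τ₀)).IsIrreducible →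
        (glRepresentation τ₀).IsIrreducible := by
  intro G _ k _ τ₀ h
  classical
  set R := glRepresentation τ₀ with hRdef
  set A := glRepresentation ((glAdZeroTwoFrame k).comp τ₀) with hAdef
  have hbot : (⊥ : Subrepresentation R).toSubmodule = ⊥ := rfl
  have htop : (⊤ : Subrepresentation R).toSubmodule = ⊤ := rfl
  haveI : Nontrivial (Subrepresentation R) := ⟨⟨⊥, ⊤, fun e => by
    have e' := congrArg Subrepresentation.toSubmodule e
    rw [hbot, htop] at e'
    exact bot_ne_top e'⟩⟩
  by_contra hirr
  obtain ⟨W, hW0, hW1⟩ : ∃ W : Subrepresentation R, W ≠ ⊥ ∧ W ≠ ⊤ := by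
    by_contra hW
    push Not at hW
    exact hirr ⟨fun W => or_iff_not_imp_left.mpr (hW W)⟩
  -- `W` is a line `k ∙ v`
  obtain ⟨v, hvW, hv0⟩ : ∃ v ∈ W.toSubmodule, v ≠ 0 := by
    by_contra hv
    push Not at hv
    exact hW0 (Subrepresentation.toSubmodule_injective
      ((Submodule.eq_bot_iff _).mpr hv |>.trans hbot.symm))
  have hWv : W.toSubmodule = k ∙ v := by
    symm
    refine Submodule.eq_of_le_of_finrank_le ((Submodule.span_singleton_le_iff_mem v _).mpr hvW) ?_
    have hlt : Module.finrank k W.toSubmodule < 2 := by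
      have := Submodule.finrank_lt (s := W.toSubmodule)
        (fun e => hW1 (Subrepresentation.toSubmodule_injective (e.trans htop.symm)))
      rwa [Module.finrank_fin_fun] at this
    rw [finrank_span_singleton hv0]
    omega
  have hstab : ∀ g, ((τ₀ g : GL (Fin 2) k) : Matrix (Fin 2) (Fin 2) k) *ᵥ v ∈ k ∙ v := fun g => by
    rw [← hWv]
    exact W.apply_mem_toSubmodule g hvW
  -- the `Ad`-stable subspace `S = {x | Φ x v = 0, Φ x (k²) ⊆ k v}`, `Φ x = (x₀ x₁; x₂ -x₀)`
  let Φ : (Fin 3 → k) →ₗ[k] Matrix (Fin 2) (Fin 2) k :=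
    (adZeroSubmodule (Fin 2) k).subtype ∘ₗ
      ((adZeroTwoEquiv k).symm : (Fin 3 → k) →ₗ[k] ↥(adZeroSubmodule (Fin 2) k))
  have hΦ : ∀ x, Φ x = !![x 0, x 1; x 2, -x 0] := fun x => rfl
  have hΦA : ∀ g x, Φ (A g x) = ((τ₀ g : GL (Fin 2) k) : Matrix (Fin 2) (Fin 2) k) * Φ x *
      (((τ₀ g)⁻¹ : GL (Fin 2) k) : Matrix (Fin 2) (Fin 2) k) := fun g x =>
    coe_adZeroTwoEquiv_symm_glAdZeroTwoFrame_mulVec (τ₀ g) x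
  let S : Subrepresentation A :=
    { toSubmodule :=
        { carrier := {x | Φ x *ᵥ v = 0 ∧ ∀ w, Φ x *ᵥ w ∈ k ∙ v}
          add_mem' := fun {x y} hx hy => by
            refine ⟨?_, fun w => ?_⟩
            · rw [map_add, Matrix.add_mulVec, hx.1, hy.1, add_zero]
            · rw [map_add, Matrix.add_mulVec]
              exact Submodule.add_mem _ (hx.2 w) (hy.2 w)
          zero_mem' := ⟨by rw [map_zero, Matrix.zero_mulVec], fun w => by
            rw [map_zero, Matrix.zero_mulVec]; exact Submodule.zero_mem _⟩
          smul_mem' := fun a x hx => by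
            refine ⟨?_, fun w => ?_⟩
            · rw [map_smul, Matrix.smul_mulVec, hx.1, smul_zero]
            · rw [map_smul, Matrix.smul_mulVec]
              exact Submodule.smul_mem _ _ (hx.2 w) }
      apply_mem_toSubmodule := fun g x hx => by
        obtain ⟨h1, h2⟩ := hx
        have hinv : (((τ₀ g)⁻¹ : GL (Fin 2) k) : Matrix (Fin 2) (Fin 2) k) *ᵥ v ∈ k ∙ v := by
          rw [← map_inv]
          exact hstab g⁻¹
        refine ⟨?_, fun w => ?_⟩
        · show Φ (A g x) *ᵥ v = 0
          rw [hΦA, ← Matrix.mulVec_mulVec, ← Matrix.mulVec_mulVec]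
          obtain ⟨a, ha⟩ := Submodule.mem_span_singleton.mp hinv
          rw [← ha, Matrix.mulVec_smul, h1, smul_zero, Matrix.mulVec_zero]
        · show Φ (A g x) *ᵥ w ∈ k ∙ v
          rw [hΦA, ← Matrix.mulVec_mulVec, ← Matrix.mulVec_mulVec]
          obtain ⟨b, hb⟩ := Submodule.mem_span_singleton.mp (h2 ((((τ₀ g)⁻¹ : GL (Fin 2) k) :
            Matrix (Fin 2) (Fin 2) k) *ᵥ w))
          rw [← hb, Matrix.mulVec_smul]
          exact Submodule.smul_mem _ _ (hstab g) }
  -- `S ≠ ⊥`: it contains `x₀ = (-v₀v₁, v₀², -v₁²)`, i.e. `Φ x₀ = v ⊗ det(v, ·)`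
  set x₀ : Fin 3 → k := ![-(v 0 * v 1), v 0 ^ 2, -(v 1 ^ 2)] with hx₀def
  have hx₀w : ∀ w : Fin 2 → k, Φ x₀ *ᵥ w = (v 0 * w 1 - v 1 * w 0) • v := fun w => by
    rw [hΦ]
    ext i
    fin_cases i <;> simp [Matrix.mulVec, dotProduct, Fin.sum_univ_two, hx₀def] <;> ring
  have hx₀S : x₀ ∈ S.toSubmodule := by
    refine ⟨?_, fun w => ?_⟩
    · show Φ x₀ *ᵥ v = 0
      rw [hx₀w, mul_comm (v 0) (v 1), sub_self, zero_smul]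
    · show Φ x₀ *ᵥ w ∈ k ∙ v
      rw [hx₀w]
      exact Submodule.smul_mem _ _ (Submodule.mem_span_singleton_self v)
  have hx₀ne : x₀ ≠ 0 := by
    intro hz
    apply hv0
    have h1 : v 0 ^ 2 = 0 := by
      have := congrFun hz 1
      simpa [hx₀def] using this
    have h2 : v 1 ^ 2 = 0 := by
      have := congrFun hz 2
      simpa [hx₀def] using this
    ext i
    fin_cases i
    · exact pow_eq_zero_iff two_ne_zero |>.mp h1
    · exact pow_eq_zero_iff two_ne_zero |>.mp h2
  -- `S ≠ ⊤`: it misses `x₁ = (1, 0, 0)`, i.e. `Φ x₁ = diag(1, -1)`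
  set x₁ : Fin 3 → k := ![1, 0, 0] with hx₁def
  have hx₁S : x₁ ∉ S.toSubmodule := by
    rintro ⟨h1, -⟩
    apply hv0
    have h1' : Φ x₁ *ᵥ v = ![v 0, -v 1] := by
      rw [hΦ]
      ext i
      fin_cases i <;> simp [Matrix.mulVec, dotProduct, Fin.sum_univ_two, hx₁def]
    rw [h1'] at h1
    ext i
    fin_cases i
    · simpa using congrFun h1 0
    · have := congrFun h1 1
      simpa using this
  haveI := h
  rcases eq_bot_or_eq_top S with hS | hS
  · apply hx₀ne
    have hmem : x₀ ∈ (⊥ : Subrepresentation A).toSubmodule := hS ▸ hx₀S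
    exact (Submodule.mem_bot k).mp hmem
  · apply hx₁S
    rw [hS]
    exact Submodule.mem_top

end AdZeroIrred

end Summit.Langlands.Langlands.Cruxes.AdjointLiftingGL3.Birth

end
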